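import Mathlib.Algebra.BigOperators.Group.Finset.Basic
import Mathlib.Algebra.Field.Basic
import Mathlib.Data.Finset.Card
import Mathlib.Algebra.BigOperators.GroupWithZero.Finset
import Mathlib.Data.Fintype.Card
import Mathlib.Algebra.BigOperators.Ring.Finset
import HarnessLib

/-!
# Compound rigidity — the combinatorial core of THEOREM SH (semi-homogeneous zero loci are not Bloch seeds)

Cell `pub-hsemireg`, track S4-PUSH corner 1′ (n = 4 non-secant seeds; s4-search-1 from g12), THEOREM SH of
`s4push/search-1/N4-NOTE-search-1.md` (1.4), registry S4-PR-71. HONEST FRAMING: pure finite combinatorics of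
products over `k`-subsets of a finite index type with values in a field. Nothing here is a statement about any
abelian variety, bundle, section or class, and nothing here bears on HC / HC_CM / HC_AV. The dictionary step
(the `k`-th compound of a diagonalisable hermitian matrix is diagonal in the wedge basis of eigenvectors, with
entries the `k`-fold products of eigenvalues; `δ^k ∝ h^k` ⟺ `C_k(H) ∝ I`) is pencil and is NOT formalised here.

* `prod_const_of_subsets` (rigidity, non-zero case): if every `k`-subset `S` of `Fin N` has the same product
  `∏_{i ∈ S} x i = c` with `c ≠ 0` and `1 ≤ k < N`, then `x` is constant.
* `card_support_lt_of_prod_zero` (zero case): if every `k`-subset has product `0` (and `1 ≤ k ≤ N`), then fewer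
  than `k` of the `x i` are non-zero — i.e. the matrix has rank `≤ k - 1`.
-/

namespace Summit.Ventures.HSemireg.CompoundRigidity

open Finset

/-- Swapping one element of a `k`-subset: if `i ∈ S`, `j ∉ S`, then `insert j (S.erase i)` has the same
cardinality as `S`. -/
theorem card_insert_erase_of_mem_of_not_mem {N : ℕ} (S : Finset (Fin N)) {i j : Fin N} (hi : i ∈ S)
    (hj : j ∉ S) : (insert j (S.erase i)).card = S.card := by
  have hj' : j ∉ S.erase i := fun h => hj (Finset.mem_of_mem_erase h)
  rw [Finset.card_insert_of_notMem hj', Finset.card_erase_of_mem hi]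
  have : 0 < S.card := Finset.card_pos.mpr ⟨i, hi⟩
  omega

/-- For `i ≠ j` in `Fin N` and `1 ≤ k < N` there is a `k`-subset containing `i` and avoiding `j`. -/
theorem exists_subset_mem_not_mem {N k : ℕ} (hk : 1 ≤ k) (hkN : k < N) {i j : Fin N} (hij : i ≠ j) :
    ∃ S : Finset (Fin N), S.card = k ∧ i ∈ S ∧ j ∉ S := by
  -- choose k - 1 elements among the N - 2 elements different from i and j
  have hcard : k - 1 ≤ ((Finset.univ.erase j).erase i).card := by
    rw [Finset.card_erase_of_mem (Finset.mem_erase.mpr ⟨hij, Finset.mem_univ i⟩),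
      Finset.card_erase_of_mem (Finset.mem_univ j), Finset.card_univ, Fintype.card_fin]
    omega
  obtain ⟨t, ht, htcard⟩ := Finset.exists_subset_card_eq hcard
  refine ⟨insert i t, ?_, Finset.mem_insert_self i t, ?_⟩
  · have hit : i ∉ t := fun h => Finset.notMem_erase i _ (ht h)
    rw [Finset.card_insert_of_notMem hit, htcard]
    omega
  · intro hj
    rcases Finset.mem_insert.mp hj with h | h
    · exact hij h.symm
    · exact (Finset.mem_erase.mp (Finset.mem_of_mem_erase (ht h))).1 rfl |>.elim

/-- **Compound rigidity, non-zero case.** If all `k`-subsets of `Fin N` (`1 ≤ k < N`) have the same product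
`c ≠ 0`, then `x i = x j` for all `i, j`. (For the eigenvalues of a hermitian `2n × 2n` matrix `H` and
`k = n + 1 ≤ 2n - 1` this is «`C_{n+1}(H) = c·I`, `c ≠ 0` ⟹ `H ∝ I`».) -/
theorem prod_const_of_subsets {F : Type*} [Field F] {N k : ℕ} (hk : 1 ≤ k) (hkN : k < N) (x : Fin N → F)
    (c : F) (hc : c ≠ 0) (h : ∀ S : Finset (Fin N), S.card = k → ∏ i ∈ S, x i = c) (i j : Fin N) :
    x i = x j := by
  by_cases hij : i = j
  · rw [hij]
  obtain ⟨S, hS, hiS, hjS⟩ := exists_subset_mem_not_mem hk hkN hij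
  have hS' : (insert j (S.erase i)).card = k := by rw [card_insert_erase_of_mem_of_not_mem S hiS hjS, hS]
  have h1 : x i * ∏ l ∈ S.erase i, x l = c := by rw [Finset.mul_prod_erase S x hiS]; exact h S hS
  have hj' : j ∉ S.erase i := fun hh => hjS (Finset.mem_of_mem_erase hh)
  have h2 : x j * ∏ l ∈ S.erase i, x l = c := by rw [← Finset.prod_insert hj']; exact h _ hS'
  have hR : ∏ l ∈ S.erase i, x l ≠ 0 := by
    intro h0
    rw [h0, mul_zero] at h1
    exact hc h1.symm
  exact mul_right_cancel₀ hR (h1.trans h2.symm)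

/-- **Compound rigidity, zero case.** If all `k`-subsets of `Fin N` (`k ≤ N`) have product `0`, then fewer than
`k` of the `x i` are non-zero: the support has cardinality `< k`. (For eigenvalues: «`C_k(H) = 0` ⟹
`rank H ≤ k - 1`».) -/
theorem card_support_lt_of_prod_zero {F : Type*} [Field F] [DecidableEq F] {N k : ℕ} (x : Fin N → F)
    (h : ∀ S : Finset (Fin N), S.card = k → ∏ i ∈ S, x i = 0) :
    (Finset.univ.filter fun i => x i ≠ 0).card < k := by
  by_contra hlt
  have hle : k ≤ (Finset.univ.filter fun i => x i ≠ 0).card := Nat.le_of_not_lt hlt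
  obtain ⟨S, hS, hScard⟩ := Finset.exists_subset_card_eq hle
  have hprod : ∏ i ∈ S, x i ≠ 0 :=
    Finset.prod_ne_zero_iff.mpr fun i hi => (Finset.mem_filter.mp (hS hi)).2
  exact hprod (h S hScard)

/-- **The dichotomy used by THEOREM SH** (combined statement): under «all `k`-subset products equal `c`» with
`1 ≤ k < N`, either `c ≠ 0` and `x` is constant, or `c = 0` and fewer than `k` entries of `x` are non-zero. -/
theorem rigidity_dichotomy {F : Type*} [Field F] [DecidableEq F] {N k : ℕ} (hk : 1 ≤ k) (hkN : k < N)
    (x : Fin N → F)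
    (c : F) (h : ∀ S : Finset (Fin N), S.card = k → ∏ i ∈ S, x i = c) :
    (c ≠ 0 ∧ ∀ i j : Fin N, x i = x j) ∨ (c = 0 ∧ (Finset.univ.filter fun i => x i ≠ 0).card < k) := by
  by_cases hc : c = 0
  · right
    refine ⟨hc, card_support_lt_of_prod_zero x fun S hS => ?_⟩
    rw [h S hS, hc]
  · left
    exact ⟨hc, prod_const_of_subsets hk hkN x c hc h⟩

end Summit.Ventures.HSemireg.CompoundRigidity
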